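import Summits.CriticalPhenomena.Ising3DConformalLimit.Theorems.SynchronousCouplingRotationJoiningIsotropyRotation
import Summits.CriticalPhenomena.Ising3DConformalLimit.Theorems.HyperoctahedralRPExistsScaleCovariantLimitIntMeshOfBlockLimitsAux
import Summits.CriticalPhenomena.Ising3DConformalLimit.Theorems.MoebiusLimitExists.Negative.RatioRegular
import HarnessLib

/-!
# Route `SynchronousCoupling`, crux `RotationJoining` (stmt-CriticalPhenomena-18763), line `SketchIdeator2` (reshape 2) —
# far-field comparison of tilted and axis `k`-point summands (lead's tool for `stub_isotropyTransfer`)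

For a rotation-invariant pointwise scaling limit `S` of the critical `ℤ³` Ising correlators under the pinned renormalisation
`ρ_pin`, continuous off the diagonals, and for configurations `y ∈ (ℤ³)ᵏ` inside a window `|yₗ| ≤ M n` whose points are
`r n`-separated, the rescaled `k`-point functions at the TILTED points `ψ⁻¹(yₗ)` and at the AXIS points `yₗ` agree up to `ε`
for `n ≥ N(ε, r, M)`:
`|ρ_pin(1/n)ᵏ ⟨∏σ_{ψ⁻¹ yₗ}⟩ − ρ_pin(1/n)ᵏ ⟨∏σ_{yₗ}⟩| ≤ ε`.
Proof: both values are the rescaled correlator at mesh `1/n` evaluated at the points `ψ⁻¹(y)/n`, `y/n` (lattice-exact); on the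
compact set of bounded, `r/2`-separated configurations the rescaled correlator is uniformly within `ε/3` of `S_k` and `S_k` is
uniformly continuous; `ψ⁻¹(y)/n` is within `2/n` of `R(y/n)`, `R = T⁻¹` the commensurate rotation (`norm_psiInv_sub_rotation_le`),
and `S_k ∘ R = S_k` (`IsRotationInvariant`). References: Kozma 2007 §6.1; Duminil-Copin ICM 2022 §8.1. No definitions, no sorry.
-/

noncomputable section

namespace Summit.CriticalPhenomena.Ising3DConformalLimit.Cruxes.RotationJoining.RateSplitting

open Literature.Probability.LatticeModels Filter Set Metric
open scoped Topology
open Summit.CriticalPhenomena.Ising3DConformalLimit.MoebiusLimitExistsOnlyInteraction (rhoPin)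
open Summit.CriticalPhenomena.Ising3DConformalLimit.Cruxes.ExistsScaleCovariantLimit.MonotoneBlockingPort
  (latticeApprox_toLp_intCast_div)
open Summit.CriticalPhenomena.Ising3DConformalLimit.MoebiusLimitExistsNegative (abs_apply_le_norm norm_le_two_mul_of_abs_le)

/-- The rescaled correlator at mesh `1/n` at the lattice-exact points `(zₗ/n)ₗ`, `z ∈ (ℤ³)ᵏ`, is `ρ(1/n)ᵏ ⟨∏ σ_{zₗ}⟩`. [folklore] -/
theorem rescaledCorrelator_intPoints {n : ℕ} (hn : n ≠ 0) (k : ℕ) (z : Fin k → Site 3) :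
    rescaledCorrelator (criticalCorr 3) rhoPin k (1 / (n : ℝ))
        (fun l => (WithLp.toLp 2 fun i => ((z l i : ℤ) : ℝ) / (n : ℝ) : EuclideanSpace ℝ (Fin 3))) =
      rhoPin (1 / (n : ℝ)) ^ k * criticalCorr 3 k z := by
  rw [rescaledCorrelator_apply]
  congr 2
  funext l
  exact latticeApprox_toLp_intCast_div hn (z l)

/-- **The set of bounded, separated configurations is compact and lies off the diagonals.** For `C` and `s > 0`,
`K = {x ∈ (ℝ³)ᵏ | ∀ l, ‖xₗ‖ ≤ C ∧ ∀ l ≠ l', s ≤ ‖xₗ − x_{l'}‖}` is compact and `K ⊆ NonCoincident 3 k`. [folklore] -/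
theorem isCompact_sepConfigs (k : ℕ) (C s : ℝ) (hs : 0 < s) :
    IsCompact {x : Fin k → EuclideanSpace ℝ (Fin 3) |
        (∀ l, ‖x l‖ ≤ C) ∧ ∀ l l', l ≠ l' → s ≤ ‖x l - x l'‖} ∧
      {x : Fin k → EuclideanSpace ℝ (Fin 3) |
        (∀ l, ‖x l‖ ≤ C) ∧ ∀ l l', l ≠ l' → s ≤ ‖x l - x l'‖} ⊆ NonCoincident 3 k := by
  constructor
  · refine Metric.isCompact_of_isClosed_isBounded ?_ ?_
    · have h1 : IsClosed {x : Fin k → EuclideanSpace ℝ (Fin 3) | ∀ l, ‖x l‖ ≤ C} := by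
        rw [Set.setOf_forall]
        exact isClosed_iInter fun l => isClosed_le (continuous_apply l).norm continuous_const
      have h2 : IsClosed {x : Fin k → EuclideanSpace ℝ (Fin 3) | ∀ l l', l ≠ l' → s ≤ ‖x l - x l'‖} := by
        rw [Set.setOf_forall]
        refine isClosed_iInter fun l => ?_
        rw [Set.setOf_forall]
        refine isClosed_iInter fun l' => ?_
        by_cases hll : l = l'
        · simp [hll]
        · have : {x : Fin k → EuclideanSpace ℝ (Fin 3) | l ≠ l' → s ≤ ‖x l - x l'‖} =
              {x | s ≤ ‖x l - x l'‖} := by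
            ext x; simp [hll]
          rw [this]
          exact isClosed_le continuous_const (((continuous_apply l).sub (continuous_apply l')).norm)
      simpa only [Set.setOf_and] using h1.inter h2
    · rw [isBounded_iff_forall_norm_le]
      refine ⟨max C 0, fun x hx => ?_⟩
      exact (pi_norm_le_iff_of_nonneg (le_max_right _ _)).2 fun l => (hx.1 l).trans (le_max_left _ _)
  · intro x hx
    rw [mem_nonCoincident]
    intro l l' h
    by_contra hll
    have := hx.2 l l' hll
    rw [h, sub_self, norm_zero] at this
    exact absurd this (not_le.2 hs)

/-- **Far-field comparison of tilted and axis `k`-point summands.** Let `S` be a pointwise scaling limit of `criticalCorr 3`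
under `ρ_pin` which is rotation invariant and continuous off the diagonals, and assume `TiltGeometry`. For every window
size `M`, separation `r > 0` and `ε > 0` there is `N` such that for `n ≥ N` and every configuration `y ∈ (ℤ³)ᵏ` with
`|yₗᵢ| ≤ M n` and `rn`-separated points (`∀ l ≠ l' ∃ i, r n ≤ |yₗᵢ − y_{l'ᵢ}|`):
`|ρ_pin(1/n)ᵏ ⟨∏ₗ σ_{ψ⁻¹(yₗ)}⟩_{β_c} − ρ_pin(1/n)ᵏ ⟨∏ₗ σ_{yₗ}⟩_{β_c}| ≤ ε`. [folklore] -/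
theorem farField_tilt_sub_axis {S : CorrFamily 3} (hS : HasPointwiseScalingLimit (criticalCorr 3) rhoPin S)
    (hrot : IsRotationInvariant S) (hcont : ∀ n, ContinuousOn (S n) (NonCoincident 3 n)) (hTG : TiltGeometry)
    (k : ℕ) (M r ε : ℝ) (hr : 0 < r) (hε : 0 < ε) :
    ∃ N : ℕ, 1 ≤ N ∧ ∀ n : ℕ, N ≤ n → ∀ y : Fin k → Site 3,
      (∀ l i, |((y l i : ℤ) : ℝ)| ≤ M * n) →
      (∀ l l', l ≠ l' → ∃ i, r * n ≤ |((y l i : ℤ) : ℝ) - ((y l' i : ℤ) : ℝ)|) →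
      |rhoPin (1 / (n : ℝ)) ^ k * criticalCorr 3 k (fun l => psiInv (y l)) -
          rhoPin (1 / (n : ℝ)) ^ k * criticalCorr 3 k y| ≤ ε := by
  obtain ⟨R, hR⟩ := exists_rotation_transpose
  -- the compact set of bounded separated configurations
  have hM0 : 0 ≤ max M 0 := le_max_right _ _
  set C : ℝ := 2 * (2 * max M 0 + 3) with hC
  set K : Set (Fin k → EuclideanSpace ℝ (Fin 3)) :=
    {x | (∀ l, ‖x l‖ ≤ C) ∧ ∀ l l', l ≠ l' → r / 2 ≤ ‖x l - x l'‖} with hK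
  obtain ⟨hKc, hKsub⟩ := isCompact_sepConfigs k C (r / 2) (by positivity)
  -- uniform convergence on `K`
  have hU : TendstoUniformlyOn (rescaledCorrelator (criticalCorr 3) rhoPin k) (S k) (𝓝[>] (0:ℝ)) K :=
    (tendstoLocallyUniformlyOn_iff_forall_isCompact (isOpen_nonCoincident 3 k)).1 (hS k) K hKsub hKc
  have hε3 : 0 < ε / 3 := by positivity
  have hev := (Metric.tendstoUniformlyOn_iff.1 hU) (ε / 3) hε3
  rw [eventually_nhdsWithin_iff, Metric.eventually_nhds_iff] at hev
  obtain ⟨δ₀, hδ₀, hδ⟩ := hev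
  -- uniform continuity of `S k` on `K`
  have hUC : UniformContinuousOn (S k) K := hKc.uniformContinuousOn_of_continuous ((hcont k).mono hKsub)
  obtain ⟨η, hη, hηS⟩ := (Metric.uniformContinuousOn_iff.1 hUC) (ε / 3) hε3
  -- the threshold
  obtain ⟨N, hN⟩ := exists_nat_gt (max (max (1 / δ₀) (2 / η)) (8 / r))
  have hNpos : (0:ℝ) < N := lt_of_le_of_lt (by positivity) hN
  have hN1 : 1 ≤ N := Nat.one_le_iff_ne_zero.2 (by rintro rfl; simp at hNpos)
  refine ⟨N, hN1, fun n hn y hwin hfar => ?_⟩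
  have hn0 : n ≠ 0 := by omega
  have hnpos : (0:ℝ) < n := by exact_mod_cast Nat.pos_of_ne_zero hn0
  have hnN : (N:ℝ) ≤ n := by exact_mod_cast hn
  have hlt : max (max (1 / δ₀) (2 / η)) (8 / r) < n := lt_of_lt_of_le hN hnN
  have h1 : 1 / δ₀ < n := lt_of_le_of_lt ((le_max_left _ _).trans (le_max_left _ _)) hlt
  have h2 : 2 / η < n := lt_of_le_of_lt ((le_max_right _ _).trans (le_max_left _ _)) hlt
  have h3 : 8 / r < n := lt_of_le_of_lt (le_max_right _ _) hlt
  -- the mesh `1/n` is admissible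
  have hmesh : dist (1 / (n:ℝ)) 0 < δ₀ ∧ (1 / (n:ℝ)) ∈ Set.Ioi 0 := by
    refine ⟨?_, by simp [hnpos]⟩
    rw [dist_zero_right, Real.norm_eq_abs, abs_of_pos (by positivity)]
    rw [div_lt_iff₀ hδ₀] at h1
    rw [div_lt_iff₀ hnpos]
    linarith
  -- the two configurations and the rotated one
  set xA : Fin k → EuclideanSpace ℝ (Fin 3) :=
    fun l => WithLp.toLp 2 fun i => ((y l i : ℤ) : ℝ) / (n : ℝ) with hxA
  set xT : Fin k → EuclideanSpace ℝ (Fin 3) :=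
    fun l => WithLp.toLp 2 fun i => ((psiInv (y l) i : ℤ) : ℝ) / (n : ℝ) with hxT
  set xR : Fin k → EuclideanSpace ℝ (Fin 3) := fun l => R (xA l) with hxR
  -- `xT` is within `2/n` of `xR`
  have hTR : ∀ l, ‖xT l - xR l‖ ≤ 2 / n := fun l =>
    norm_psiInv_sub_rotation_le hTG hR (Nat.one_le_iff_ne_zero.2 hn0) (y l)
  have h2n : (2:ℝ) / n < η := by
    rw [div_lt_iff₀ hη] at h2; rw [div_lt_iff₀ hnpos]; linarith
  have h4n : (4:ℝ) / n ≤ r / 2 := by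
    rw [div_lt_iff₀ hr] at h3; rw [div_le_iff₀ hnpos]; linarith
  -- norms of the axis points
  have hxA_norm : ∀ l, ‖xA l‖ ≤ 2 * max M 0 := by
    intro l
    refine norm_le_two_mul_of_abs_le fun i => ?_
    show |((y l i : ℤ) : ℝ) / (n : ℝ)| ≤ max M 0
    rw [abs_div, abs_of_pos hnpos, div_le_iff₀ hnpos]
    exact (hwin l i).trans (mul_le_mul_of_nonneg_right (le_max_left _ _) hnpos.le)
  -- separations of the axis points
  have hxA_sep : ∀ l l', l ≠ l' → r ≤ ‖xA l - xA l'‖ := by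
    intro l l' hll
    obtain ⟨i, hi⟩ := hfar l l' hll
    have hc : |(xA l - xA l') i| = |((y l i : ℤ) : ℝ) - ((y l' i : ℤ) : ℝ)| / n := by
      show |((y l i : ℤ) : ℝ) / (n : ℝ) - ((y l' i : ℤ) : ℝ) / (n : ℝ)| = _
      rw [← sub_div, abs_div, abs_of_pos hnpos]
    have := abs_apply_le_norm (xA l - xA l') i
    rw [hc] at this
    exact ((le_div_iff₀ hnpos).2 hi).trans this
  -- membership in `K`
  have hC1 : 2 * max M 0 ≤ C := by rw [hC]; nlinarith
  have hxA_mem : xA ∈ K := ⟨fun l => (hxA_norm l).trans hC1,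
    fun l l' hll => by linarith [hxA_sep l l' hll]⟩
  have hxR_mem : xR ∈ K := by
    refine ⟨fun l => ?_, fun l l' hll => ?_⟩
    · show ‖R (xA l)‖ ≤ C
      rw [LinearIsometryEquiv.norm_map]; exact (hxA_norm l).trans hC1
    · show r / 2 ≤ ‖R (xA l) - R (xA l')‖
      rw [← map_sub, LinearIsometryEquiv.norm_map]; linarith [hxA_sep l l' hll]
  have hxT_mem : xT ∈ K := by
    refine ⟨fun l => ?_, fun l l' hll => ?_⟩
    · calc ‖xT l‖ = ‖(xT l - xR l) + xR l‖ := by rw [sub_add_cancel]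
        _ ≤ ‖xT l - xR l‖ + ‖xR l‖ := norm_add_le _ _
        _ ≤ 2 / n + 2 * max M 0 := add_le_add (hTR l) (by
            show ‖R (xA l)‖ ≤ _; rw [LinearIsometryEquiv.norm_map]; exact hxA_norm l)
        _ ≤ C := by
            rw [hC]
            have : (2:ℝ) / n ≤ 2 := by
              rw [div_le_iff₀ hnpos]
              have : (1:ℝ) ≤ n := by exact_mod_cast Nat.one_le_iff_ne_zero.2 hn0
              linarith
            nlinarith
    · have hRsep : r ≤ ‖xR l - xR l'‖ := by
        show r ≤ ‖R (xA l) - R (xA l')‖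
        rw [← map_sub, LinearIsometryEquiv.norm_map]; exact hxA_sep l l' hll
      have htri : ‖xR l - xR l'‖ ≤ ‖xT l - xR l‖ + ‖xT l - xT l'‖ + ‖xT l' - xR l'‖ := by
        have e : xR l - xR l' = -(xT l - xR l) + (xT l - xT l') + (xT l' - xR l') := by abel
        calc ‖xR l - xR l'‖ = ‖-(xT l - xR l) + (xT l - xT l') + (xT l' - xR l')‖ := by rw [← e]
          _ ≤ ‖-(xT l - xR l) + (xT l - xT l')‖ + ‖xT l' - xR l'‖ := norm_add_le _ _
          _ ≤ ‖-(xT l - xR l)‖ + ‖xT l - xT l'‖ + ‖xT l' - xR l'‖ := by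
              gcongr; exact norm_add_le _ _
          _ = _ := by rw [norm_neg]
      have := hTR l; have := hTR l'
      have h22 : (2:ℝ) / n + 2 / n = 4 / n := by ring
      linarith
  -- the four-term estimate
  have eA : rescaledCorrelator (criticalCorr 3) rhoPin k (1 / (n:ℝ)) xA = rhoPin (1 / (n:ℝ)) ^ k * criticalCorr 3 k y :=
    rescaledCorrelator_intPoints hn0 k y
  have eT : rescaledCorrelator (criticalCorr 3) rhoPin k (1 / (n:ℝ)) xT =
      rhoPin (1 / (n:ℝ)) ^ k * criticalCorr 3 k (fun l => psiInv (y l)) :=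
    rescaledCorrelator_intPoints hn0 k (fun l => psiInv (y l))
  have cA := hδ hmesh.1 hmesh.2 xA hxA_mem
  have cT := hδ hmesh.1 hmesh.2 xT hxT_mem
  have hrotR : S k xR = S k xA := hrot k R xA
  have hdist : dist xT xR < η := by
    refine lt_of_le_of_lt ((dist_pi_le_iff (by positivity)).2 fun l => ?_) h2n
    rw [dist_eq_norm]; exact hTR l
  have cS := hηS xT hxT_mem xR hxR_mem hdist
  rw [Real.dist_eq] at cA cT cS
  rw [← eA, ← eT]
  have hfin : |rescaledCorrelator (criticalCorr 3) rhoPin k (1 / ↑n) xT -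
        rescaledCorrelator (criticalCorr 3) rhoPin k (1 / ↑n) xA|
      ≤ |S k xT - rescaledCorrelator (criticalCorr 3) rhoPin k (1 / ↑n) xT| + |S k xT - S k xR| +
        |S k xR - rescaledCorrelator (criticalCorr 3) rhoPin k (1 / ↑n) xA| := by
    have e : rescaledCorrelator (criticalCorr 3) rhoPin k (1 / ↑n) xT -
          rescaledCorrelator (criticalCorr 3) rhoPin k (1 / ↑n) xA
        = -(S k xT - rescaledCorrelator (criticalCorr 3) rhoPin k (1 / ↑n) xT) + (S k xT - S k xR) +
          (S k xR - rescaledCorrelator (criticalCorr 3) rhoPin k (1 / ↑n) xA) := by ring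
    rw [e]
    refine (abs_add_three _ _ _).trans_eq ?_
    rw [abs_neg]
  rw [hrotR] at hfin cS
  linarith

end Summit.CriticalPhenomena.Ising3DConformalLimit.Cruxes.RotationJoining.RateSplitting

end
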